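import Mathlib.NumberTheory.Cyclotomic.Basic
import Literature.NumberTheory.EllipticCurves.IwasawaSelmerEigen
import Literature.NumberTheory.EllipticCurves.SelmerPInftyRestriction
import Literature.NumberTheory.EllipticCurves.Wuthrich2014.ReducibleDivisibilityCyclotomicThree
import Literature.NumberTheory.EllipticCurves.PAdicLFunctionMinusMult
import Literature.NumberTheory.EllipticCurves.PAdicLFunctionPlusMult
import Literature.NumberTheory.EllipticCurves.PAdicLFunctionBranch
import HarnessLib

/-!
# Wuthrich 2014, Thm. 16 at an odd prime `p` of SEMISTABLE reduction (good ordinary, split or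
# non-split multiplicative), `E[p]` reducible — the SINGLE component `i = (p−1)/2`:
# `char_{Λ(Γ)}(e_{(p−1)/2} X(E/ℚ(ζ_{p^∞}))) ∋ u · L_p(E, ω^{(p−1)/2}, T)`, read on the
# `χ_{ℚ(√p*)}`-eigenspace of `Sel_{p^∞}(E/ℚ(μ_{p^∞}))` in the subgroup model over `Γ_ℚ` (named fact;
# the general-`p` parent of A122 and of the good-ordinary component reading A125)

Source: C. Wuthrich, *On the integrality of modular symbols and Kato's Euler system for elliptic
curves*, Doc. Math. 19 (2014) 381–402 [Wuthrich2014]. **Theorem 16** (p. 397): "Let `E/ℚ` be an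
elliptic curve and let `p > 2` be a prime. Suppose that `E` has semi-stable reduction at `p` and that
`E[p]` is reducible as a `G_ℚ`-module. Then `char_Λ X(E)` divides the ideal generated by `L_p(E)`. If
the reduction of `E` is split multiplicative at `p`, then `I · char_Λ X(E)` divides the ideal
generated by `L_p(E)`, where `I` is the kernel of the homomorphism `Λ → ℤ_p` that sends all elements
of [the group to `1`]." §1 Thm. 3 (p. 383): "We formulate it here for the full cyclotomic
`ℤ_p^×`-extension." §3 (p. 390): "Any `Λ`-module `M` comes equipped with an action by the group
`Δ = Gal(ℚ(ζ_p)/ℚ)` and we split `M` up into the eigenspaces `M = ⊕_{i=0}^{p−2} M_i` where `Δ` acts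
on `M_i = M(−i)^Δ` by the `i`-th power of the Teichmüller character." §4 (p. 396): "For any torsion
`Λ`-module `M`, we define the characteristic series `char_Λ(M)` as the product of the ideals
`𝔭^{l_𝔭}` where `l_𝔭 = length_{Λ_𝔭}(M_𝔭)` as `𝔭` runs through all primes of height `1` in `Λ`."
§5 (p. 397): `X(E)` = "the dual of the limit of the Selmer group" over `ℚ(ζ_{p^n})` ("defined as
usual as the elements … that are locally in the image of the points"), "a finitely generated
`Λ`-module. If the reduction is good ordinary, theorem 17.4 in [Kato] shows that `X(E)` is
`Λ`-torsion. The same conclusion holds in general in our situation; see [Kobayashi 2006] for the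
split multiplicative case." §3.2 (p. 394): at a non-split multiplicative prime the Coleman map "is
injective and has finite cokernel"; at a split multiplicative prime "Theorem 4.1 in [Kobayashi
2006] proves that the Coleman map … is injective and has image with finite index inside `I`".
Cor. 18 (p. 398): "`L_p(E)` belongs to `Λ` for all elliptic curves `E/ℚ` with semi-stable reduction
at `p > 2`." Torsion over the abelian base `ℚ(ζ_p)` also: Greenberg, LNM 1716 (1999) Thm. 1.5
(Kato–Rohrlich), PDF p. 61; the eigenspace descent display: LNM 1716 §5 p. 143.

ONE NAMED FACT (`def … : Prop`, nothing asserted, D-0014/D-0026): Theorem 16 at an odd prime `p` of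
SEMISTABLE reduction — all three local types: good ordinary (two-term measure, unit root `α`), split
multiplicative (one-term measure, `a = +1`), non-split multiplicative (`a = −1`) — READ ON THE SINGLE
EIGENCOMPONENT `i = m := (p−1)/2`, stated, as the `p = 3` member `thm16_minusEigenCharIdeal_dvd_cyclotomicThree`
(A122), in the Literature eigen-Selmer vocabulary `WeierstrassCurve.EigenSelmerDualData` (file
`IwasawaSelmerEigen`; Greenberg §5 p. 143 `Y^θ`, Wuthrich §3 p. 390 `M_i`). It is the general-`p`
PARENT of A122 (`p = 3`, `F = K = ℚ(ζ₃)`) and of the good-ordinary component reading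
`charIdeal_dvd_padicLFunctionBranch_component` (A125, fields inlined) — both derivable from it in the
kernel — and the component form of the all-branches PRODUCT readings A117/A126/A127, which is NOT a
kernel consequence of them (a product membership does not split back into its factors), hence a
reading of its own. Literature-seat ruling C169 (2026-08-20): filed as the LAST reducible member of the
Wuthrich-16 reading family; flag family `Wu14-Thm16-pgen-branch-split` (ONE component) +
`Wu14-I-augmentation-reading` (`e_mI = e_mΛ`).

## The reading — that of the product siblings, STOPPED ONE STEP EARLIER (no multiplication over `i`)

`Λ = ℤ_p⟦G⟧`, `G = Gal(ℚ(ζ_{p^∞})/ℚ) ≅ ℤ_p^× = Δ × Γ`, `#Δ = p − 1` prime to `p`;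
`Λ = ⊕_{i=0}^{p−2} Λ(Γ)e_i` (`e_i = (p−1)⁻¹ ∑_δ ω^{−i}(δ)[δ]`), every `Λ`-module is `M = ⊕_i e_iM`
(p. 390), the height-one primes of `Λ` are those of the factors `Λ(Γ)`, so
`char_Λ(M) = ∑_i char_{Λ(Γ)}(e_iM)e_i` and "`char_Λ X(E)` divides `(L_p(E))`" SAYS
`e_iL_p(E) ∈ char_{Λ(Γ)}(e_iX)` for EVERY `i`. THIS FACT is that statement for `i = m = (p−1)/2`
(`≠ 0`). The split-multiplicative factor `I` (augmentation ideal of `Λ`) contains `e_i` for every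
`i ≠ 0` (the augmentation of `e_i` is `(p−1)⁻¹∑_δ ω^{−i}(δ) = 0`), so `e_mI = e_mΛ`: the
`ω^m`-component of "`L_p(E) ∈ I · char X(E)`" is again `e_mL_p(E) ∈ char(e_mX)` — NO extra factor
(the exceptional zero lives on `e₀`, where `e₀I = (T)`). `e_mL_p(E) = L_p(E, ω^m, T) =
∫_{ℤ_p^×} ω^m(x)(1+T)^{ℓ(x)} dμ_E(x)`, the `ω^m`-branch (MTT 1986 §I.13) of the Néron-normalised
Mazur–Tate–Teitelbaum measure: the TWO-TERM measure with the unit root `α` at a good ordinary `p`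
(`ε(p) = 1`, §I.10; tree `padicLFunctionBranch f α m` on the PLUS symbols for `m` even,
`padicLFunctionMinusBranch f α m` on the MINUS symbols for `m` odd), the ONE-TERM measure at a
multiplicative `p` (`ε(p) = 0`; allowable root `a = a_p = +1` split / `−1` non-split; tree
`padicLFunctionPlusBranchMult f a m` / `padicLFunctionMinusBranchMult f a m`) — `m` even iff
`p ≡ 1 (mod 4)` iff `Even (p / 2)`.

THE FIELD AND THE MODULE (subgroup model over `Γ_ℚ`, as A122/A124/A125). `ℚ(ζ_{p^∞}) = F·ℚ_∞` with
`F := ℚ(ζ_p)` (`IsCyclotomicExtension {p} ℚ F`) and `ℚ_∞` the cyclotomic `ℤ_p`-extension of `ℚ`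
(`κ.IsCyclotomic`): `Gal(ℚ̄/ℚ(ζ_{p^∞})) = ker κ ⊓ galRange F`, `Gal(ℚ̄/ℚ_∞) = ker κ =: H'`, and
`Δ ≅ H'/(ker κ ⊓ galRange F)` acts on `Sel_{p^∞}(E/ℚ(ζ_{p^∞})) = W.selmerGroupOver p _` (Wuthrich's
Selmer group: local conditions "in the image of the points" everywhere) by `g_*` (`conjH1`). The
character `ω^m = ω^{(p−1)/2}` of `Δ ≅ (ℤ/p)^×` is its unique QUADRATIC character; it cuts out the
quadratic subfield `K := ℚ(√p*) ⊂ ℚ(ζ_p)`, `p* = (−1)^{(p−1)/2} p` (`K` a number field of degree `2`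
containing `θ` with `θ² = p*`; `galRange K = Gal(ℚ̄/K)` for the tree's embedding — `K/ℚ` being Galois,
its image in `ℚ̄` is THE subfield `ℚ(√p*)`), so `ω^m(g) = +1` if `g ∈ galRange K` and `−1` otherwise,
for `g ∈ H'`. We carry `H := ker κ ⊓ galRange K ⊓ galRange F` (`= ker κ ⊓ galRange F`, since
`Gal(ℚ̄/F) ≤ Gal(ℚ̄/K)`; the redundant factor keeps the cell's `chiEigenSelmerIn` shape). Hence
Wuthrich's `M_m` for `M` = the Selmer group is `W.eigenSelmerGroupOver p H H' ω^m =
{t ∈ Sel : g_* t = ω^m(g)·t ∀ g ∈ H'}` and, `p` being odd (`Hom(M, ℚ_p/ℤ_p)_m = Hom(M_m, ℚ_p/ℤ_p)`;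
`ω^m = ω^{−m}` is real-valued so no contragredient ambiguity), `e_mX(E) = X(E)_m` is the Pontryagin
dual of `M_m` as a `Λ(Γ)`-module with `T = γ − 1` for `γ ∈ Gal(ℚ̄/F)` (so that `γ` restricts into
`Γ = Gal(ℚ(ζ_{p^∞})/ℚ(ζ_p))`) lifting the topological generator `χ_p(γ) = 1 + p` of `Γ`
(`IsCyclotomicVariable p γ`: `χ_p(γ)·ζ = 1 + p`, `ζ` torsion — here `χ_p(γ) ≡ 1 (mod p)` forces
`ζ = 1`; `κ.IsTopGenerator γ` normalises `κ`; `γ ∈ galRange K` is then automatic and carried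
explicitly) — EXACTLY a datum `D : W.EigenSelmerDualData p H H' ω^m γ` (file `IwasawaSelmerEigen`).

PERIODS (the only translation made, as in every sibling): Wuthrich's `[r]^±_E` are normalised by the
Néron periods `Ω^±_E` (p. 381), the tree's symbols by the newform periods; with `ϖ·Ω_E = Ω⁺_f`
(`m` even) resp. `ϖ·|Ω⁻(E)| = Ω⁻_f` (`m` odd; Pal's imaginary Néron period, a power of `2` off
Wuthrich's `Ω⁻_E`) the Néron-normalised branch is `u · ϖ · B_m` for the tree's branch `B_m` and a
`p`-adic unit `u` (signs, `c_∞`, powers of `2`), kept explicit.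

Hypotheses transcribed: `E = V` globally minimal over `ℚ`; `p ≠ 2`; SEMISTABLE at `p` as the
disjunction of the three local types, each paired with ITS branch `B` (good ordinary — for `p` good
with `E[p]` reducible the reduction is ordinary, §5 p. 397 — `IsOrdinaryAt V p` and the two-term
branch with `α = unitRoot V p`; split, the one-term branch with `a = 1`; non-split multiplicative, the
one-term branch with `a = −1`; in each case the PLUS/MINUS variant by the parity of `m`); `E[p]`
reducible; `K` of degree `2` with `θ² = p*` (`galRange K` normal — automatic for a
quadratic field, carried as an instance for the vocabulary); `F = ℚ(ζ_p)` (`galRange F` normal —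
Galois); `κ` cyclotomic with topological generator `γ ∈ galRange K ⊓ galRange F` matching the
cyclotomic variable; `f` the newform of `E`; `D` an eigen-dual datum as displayed; `ϖ` with the
period relation of the parity of `m`. Conclusion: `e_mX` is `Λ(Γ)`-torsion (a direct summand of the
torsion module `X(E)`, §5 p. 397 / Greenberg Thm. 1.5) and `u · ϖ · B = ι g` for some
`g ∈ char_{Λ(Γ)}(e_mX)`, `u ∈ ℤ_pˣ`, `ι = iwasawaToPowerSeries p`, `B` the branch of the local type.
Proposed flags: `Wu14-Thm16-pgen-branch-split` (ONE component) + `Wu14-I-augmentation-reading`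
(`e_mI = e_mΛ`, as in A107/A122). What is NOT here: the other components, `p = 2`, any proof (Kato's
Euler system is not in Mathlib). No `_holds` is to be expected. OVERLAP (by design, ruling C169): A122
(`p = 3`) and A125 (good ordinary, inline datum) are the special cases `F = K = ℚ(ζ₃)` resp. first
disjunct; kernel derivations of both from this fact are filed separately (debt-free corollaries).
-- TODO(general form): Thm. 16 componentwise for every `i mod p − 1` (with `e₀I = (T)` in the split
-- case), which needs `ℤ_p`-valued characters `ω^i` on the eigen-subgroup (the tree's
-- `eigenSelmerGroupOver` takes an integer-valued `ε`, enough for `i ∈ {0, (p−1)/2}`).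

Consumer: the BSD rank-≤1 residual cell (`b2b-bsdres`), sub-cell additive-p1 (X3♯(M): additive,
potentially MULTIPLICATIVE `p`, `E[p]` reducible): with the kernel transport
`Sel_{p^∞}(E ⊗ χ_K/ℚ_∞) ≅ Sel_{p^∞}(E/K·ℚ_∞)^{(χ_K)} ≅ e_m Sel_{p^∞}(E/ℚ(ζ_{p^∞}))`
(`AdditivePotMult/TwistDescent`, `ChiEigenSelmerDual`, additive-p2's `Additive/ChiEigenPrimeToPDescent*`)
and the `T = 0` value of `B_m` (MTT §I.14, tree theorems) this fact makes the typed input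
`ChiBranchLeadingTerm[Odd]At W p` a theorem for every `W` potentially multiplicative at `p`, hence
the rank-`0` upper half `ord_p #Ш(E) ≤ ord_p #Ш_an(E)` for every X3♯(M) curve at EVERY odd `p`
from published theorems + kernel glue (at `p = 3` already by A122); additive-p2's (G-ord) twins use the
good-ordinary disjunct. HONEST FRAMING: the cell deletes
COMBINATION-SHAPED classes from published theorems and TYPES the construction-shaped remainder;
labels of X3/X4 unchanged by this file; nothing here is "finishing BSD".
-/

set_option autoImplicit false

noncomputable section

open scoped Classical MatrixGroups ModularForm

open CongruenceSubgroup WeierstrassCurve Literature.NumberTheory.EllipticCurves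
  Literature.NumberTheory.EllipticCurves.ModularForms
  Literature.NumberTheory.GaloisRepresentations

namespace Literature.NumberTheory.EllipticCurves.Wuthrich2014

/-- **Wuthrich 2014, Theorem 16 at an odd prime `p` of SEMISTABLE reduction, `E[p]` reducible — the
component `m = (p−1)/2`: `char_{Λ(Γ)}(e_m X(E/ℚ(ζ_{p^∞}))) ∋ u · L_p(E, ω^m, T)`.** As printed (Doc. Math. 19
(2014), Thm. 16, p. 397): "Let `E/ℚ` be an elliptic curve and let `p > 2` be a prime. Suppose that
`E` has semi-stable reduction at `p` and that `E[p]` is reducible as a `G_ℚ`-module. Then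
`char_Λ X(E)` divides the ideal generated by `L_p(E)`. If the reduction of `E` is split multiplicative
at `p`, then `I · char_Λ X(E)` divides the ideal generated by `L_p(E)`" — `Λ = ℤ_p⟦Gal(ℚ(ζ_{p^∞})/ℚ)⟧`
(§1 Thm. 3: "for the full cyclotomic `ℤ_p^×`-extension"), `X(E)` the dual of
`lim_n Sel(E/ℚ(ζ_{p^n}))` (§5 p. 397; `Λ`-torsion loc. cit. / Kobayashi 2006 / Greenberg LNM 1716
Thm. 1.5), `char_Λ` the product over height-one primes (§4 p. 396), `L_p(E) ∈ Λ` (Cor. 18) the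
Néron-normalised one-term MTT measure (`ε(p) = 0`, `α = a_p = ±1`), `I` the augmentation ideal; §3
(p. 390): "we split `M` up into the eigenspaces `M = ⊕_{i=0}^{p−2} M_i` where `Δ` acts on `M_i` […]
by the `i`-th power of the Teichmüller character". Since `Λ = ⊕_i Λ(Γ)e_i` (`p ∤ #Δ`) and the
height-one primes are those of the factors, the printed divisibility says `e_iL_p(E) ∈ char(e_iX)`
for every `i`; THIS FACT IS THE COMPONENT `i = m = (p−1)/2`: `L_p(E, ω^m, T) ∈ char_{Λ(Γ)}(e_mX)`
(`e_m ∈ I`, `e_mI = e_mΛ`: no extra factor in the split case), `L_p(E, ω^m, T)` the `ω^m`-branch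
(MTT §I.13) of the two-term measure with the unit root `α` (good ordinary) resp. the one-term measure
with `a = a_p = ±1` (multiplicative) — on `[·]⁺` if `m` is even, on `[·]⁻` if `m` is odd. Field and
module: `ℚ(ζ_{p^∞}) = F·ℚ_∞`, `F = ℚ(ζ_p)`; `ω^m` = the quadratic character of `Δ`,
cutting out `K = ℚ(√p*) ⊂ F`; in the tree's subgroup model `H = ker κ ⊓ galRange K ⊓ galRange F =
Gal(ℚ̄/ℚ(ζ_{p^∞}))` (`κ` the cyclotomic `ℤ_p`-extension of `ℚ`), `H' = ker κ` acts by `g_*`,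
`ω^m(g) = ±1` according as `g ∈ galRange K`; `M_m = eigenSelmerGroupOver V p H H' ω^m` and
`e_mX = X_m` is its Pontryagin dual with `T = γ − 1`, `γ ∈ Gal(ℚ̄/F)` (hence `∈ Gal(ℚ̄/K)`) lifting
`χ_p(γ) = 1 + p` — a datum `D : V.EigenSelmerDualData p H H' ω^m γ` (file `IwasawaSelmerEigen`).
Periods: `ϖ·Ω_E = Ω⁺_f` (`m` even) / `ϖ·|Ω⁻(E)| = Ω⁻_f` (`m` odd); units in `u ∈ ℤ_pˣ`. Hypotheses:
`V` globally minimal; `p ≠ 2`; semistable at `p` as the disjunction (good ordinary, `B` = two-term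
branch with `α = unitRoot V p`) ∨ (split, `B` = one-term branch with `a = 1`) ∨ (non-split
multiplicative, `a = −1`), PLUS/MINUS by `Even (p/2)`; `V[p]` reducible; `K` (degree `2`, `θ² = p*`),
`F`, `κ`, `γ`, `f`, `D`, `ϖ` as displayed. Conclusion:
`Module.IsTorsion Λ D.X ∧ ∃ g ∈ D.charIdeal, ∃ u, ι g = C(u ϖ) · B`. The general-`p` parent of A122
(`p = 3`) and of the good-ordinary component reading A125 (both derivable from it), and the
`ω^m`-component of the product readings A117/A126/A127 (not a kernel consequence of them); flags
`Wu14-Thm16-pgen-branch-split`, `Wu14-I-augmentation-reading`; literature-seat ruling C169. Named fact;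
nothing asserted.
[cite: Wuthrich2014, Thm. 16 and §5 (p. 397), §1 Thm. 3 (p. 383), §3 (p. 390), §3.2 (p. 394), §4 (p. 396), Cor. 18 (p. 398)]
[cite: GreenbergLNM1716, Thm. 1.5 (PDF p. 61) and §5 (p. 143)]
[cite: MazurTateTeitelbaum1986Invent, §I.10, §I.13] -/
def thm16_halfEigenCharIdeal_dvd_cyclotomicPrime : Prop :=
  ∀ (p : ℕ) [Fact p.Prime] (V : WeierstrassCurve ℚ) [V.IsElliptic] [V.IsGloballyMinimal]
    (K : Type) [Field K] [NumberField K] [(galRange (K := ℚ) K).Normal]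
    (F : Type) [Field F] [NumberField F] [IsCyclotomicExtension {p} ℚ F]
    [(galRange (K := ℚ) F).Normal]
    {κ : ZpExtension ℚ p} {γ : Field.absoluteGaloisGroup ℚ} {N : ℕ} [NeZero N]
    {f : CuspForm (Gamma0 N) 2} (B : PowerSeries ℚ_[p]),
    p ≠ 2 → Module.finrank ℚ K = 2 →
    (∃ θ : K, θ ^ 2 = algebraMap ℚ K ((-1) ^ (p / 2) * p)) →
    ((IsOrdinaryAt V p ∧
        B = if Even (p / 2) then padicLFunctionBranch f ((unitRoot V p : ℤ_[p]) : ℚ_[p]) (p / 2)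
          else padicLFunctionMinusBranch f ((unitRoot V p : ℤ_[p]) : ℚ_[p]) (p / 2)) ∨
      (V.HasSplitMultiplicativeReductionAtPrime p ∧
        B = if Even (p / 2) then padicLFunctionPlusBranchMult f (1 : ℚ_[p]) (p / 2)
          else padicLFunctionMinusBranchMult f (1 : ℚ_[p]) (p / 2)) ∨
      (V.HasMultiplicativeReductionAtPrime p ∧ ¬ V.HasSplitMultiplicativeReductionAtPrime p ∧
        B = if Even (p / 2) then padicLFunctionPlusBranchMult f (-1 : ℚ_[p]) (p / 2)
          else padicLFunctionMinusBranchMult f (-1 : ℚ_[p]) (p / 2))) →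
    ¬ V.HasIrreducibleModPGaloisRep p →
    κ.IsCyclotomic → κ.IsTopGenerator γ → IsCyclotomicVariable p γ →
    γ ∈ galRange (K := ℚ) K → γ ∈ galRange (K := ℚ) F → IsNewformOf V f →
    ∀ (D : V.EigenSelmerDualData p
        (κ.kerSubgroup ⊓ galRange (K := ℚ) K ⊓ galRange (K := ℚ) F) κ.kerSubgroup
        (fun g ↦ if g ∈ galRange (K := ℚ) K then 1 else -1) γ) (ϖ : ℚ),
      (if Even (p / 2) then (ϖ : ℝ) * V.realPeriodRat = plusPeriod f
        else (ϖ : ℝ) * V.imaginaryPeriodRat = minusPeriod f) →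
      Module.IsTorsion (IwasawaAlgebra p) D.X ∧
      ∃ g ∈ D.charIdeal, ∃ u : ℤ_[p]ˣ,
        iwasawaToPowerSeries p g =
          PowerSeries.C (((u : ℤ_[p]) : ℚ_[p]) * (ϖ : ℚ_[p])) * B

end Literature.NumberTheory.EllipticCurves.Wuthrich2014

end
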